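import Summits.QuantumFields.YangMills.Theorems.ForcedResponseSkewnessResponseLocalisationFarToolkit
import Summits.QuantumFields.YangMills.Theorems.ForcedResponseSkewnessResponseLocalisationDefs
import Summits.QuantumFields.YangMills.Theorems.ForcedResponseSkewnessRunningCouplingCeilingUniformSmearPrep
import HarnessLib

/-!
# Crux `ResponseLocalisation` (repaired item stmt-QuantumFields-24293, successor of 23615), route
# `ForcedResponseSkewness`: the FAR-FIELD SMEARING THEOREM

Support file (`--supports`, helper) of the width prover `ym-line-frs-p2` (lead `ym-line-frs-p1`).  The ANALYSIS half
of a far-field stub of the repaired localisation crux, in the lead's «kernel bound (physics) + smearing (analysis)»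
pattern (cf. `PointwiseSig`/`SmearSig` of crux `RunningCouplingCeiling`):

* `far_sum_abs_smear_le` — ABSTRACT KERNEL: on the torus box of half-side `L` at spacing `0 < s ≤ 1`, for sampled
  sources `φ, ψ` vanishing outside the ball of radius `R₀` and separated in time by a wall gap `g > 0`, a torus with
  no wrap-around of the source pair (`2R₀ ≤ s L`), and a kernel with the SCALE-FREE TRIANGLE MAJORANT
  `|K x y z| ≤ A (1+d_T(x,y))⁻⁴ (1+d_T(x,z))⁻⁴ (1+d_T(y,z))⁻⁴` (torus distances, lattice units; hyperscaling of a
  dimension-4 density), the far mass obeys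
  `Σ_{x : D < ‖s x‖} |Σ_{y,z} φ(s y) ψ(s z) K x y z| ≤ 2¹⁴ A/(g⁴ D) · (s⁴Σ_y|φ(s y)|) · (s⁴Σ_z|ψ(s z)|)`
  for `D ≥ max(2, 2R₀+1)`, uniformly in `s` and `L`: the `y–z` leg pays `(s/2g)⁴`, the two `x` legs pay
  `2⁸ s⁸ (1+‖s x‖)⁻⁸`, and the far Riemann bound `s⁴Σ_{D<‖s x‖}(1+‖s x‖)⁻⁸ ≤ 1024/D` of the toolkit closes;
* `far_sum_abs_respM_le`, `far_ifsum_abs_respM_le` — SPECIALISATION to the response profile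
  `respM(x) = Σ_{y,z} θv(s y) v(s z) torusK3(x,y,z)` of the line (`…ResponseLocalisationDefs`, p589170) for a real
  Schwartz `v` with `tsupport v ⊆ closedBall p ρ`, `ρ < p₀` (so `R₀ = ‖p‖ + ρ`, `g = p₀ − ρ`; the support
  bookkeeping `norm_le_of_apply_ne_zero`, `norm_le_of_thetaTest_apply_ne_zero` uses that `θ` is an isometry
  reversing time): `Σ_{x : D < ‖s x‖} |respM(x)| ≤ 2¹⁴ A/((p₀−ρ)⁴ D) · (s⁴Σ|θv(s·)|)(s⁴Σ|v(s·)|)` whenever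
  `|torusK3| ≤ A ·` triangle majorant on the box — the physics input (an E0′-type third-cumulant ceiling WITH
  pairwise decay, uniform on tori; beyond the landed scale-free `MomentBounds6`) is NOT proved here.

* `far_ceiling_uniform` — the ε-FORM in the quantifier order of item 24293: `∀ p, ρ < p₀, A ≥ 0, η > 0 ∃ D > 0 ∀ v`
  (`tsupport v ⊆ closedBall p ρ`, `∫|v| ≤ 1`) `∃ s₀ > 0 ∀ 0 < s ≤ s₀ ∀ L` (`2(‖p‖+ρ) ≤ s L`) `∀ β` with the majorant:
  `Σ_{x ∈ box L} 𝟙{D < ‖s x‖}|respM(x)| ≤ η` — the two lattice `ℓ¹`-sums are `≤ ‖v‖₁ + 1 ≤ 2` for small `s` by the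
  width seat p3's `…UniformSmearPrep.exists_latticeSum_abs_le` (and `∫|θv| = ∫|v|`), which is where `D` becomes
  uniform over the `L¹`-normalised family.

Honest label: a helper toward ONE stub of a CONDITIONAL rung line (leaf R2a `BalabanLadder.NT`); the crux, NT and the
route remain open; nothing here bears on the Yang–Mills mass gap, which is NOT proved by any of this.
Refs: Glimm–Jaffe (1987) §9.5 (lattice Riemann sums); route file `Theses/ForcedResponseSkewness.lean`; line card
`Cruxes/ResponseLocalisation/Lines/birth.md` (stub_far: «hyperscaling |K3| ≲ dist⁻¹² gives a summable tail»).
-/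

set_option autoImplicit false

noncomputable section

namespace Summit.QuantumFields.YangMills.Cruxes.ResponseLocalisation.Far

open Set Metric Filter Topology Finset
open scoped SchwartzMap
open Literature.MathematicalPhysics.QuantumLattice Literature.Probability.LatticeModels
open Summit.QuantumFields.YangMills.Cruxes.RunningCouplingCeiling.Pointwise

/-! ## The far-field smearing theorem (abstract kernel) -/

/-! The leg weight of the scale-free TRIANGLE MAJORANT in lattice units is `ω(d) = (1 + d)^{-4}` (hyperscaling of a
dimension-4 density: each leg of the one-loop triangle decays like the fourth power of the lattice distance); it is
spelled out as `((1 + d) ^ 4)⁻¹` throughout (no definition is introduced). -/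

/-- Rescaling of the leg weight: if `0 < b ≤ c (1 + d)` (`0 ≤ d`) then `(1 + d)^{-4} ≤ (c/b)^4`. [folklore] -/
theorem inv_one_add_pow_four_le_div_pow {d b c : ℝ} (hd : 0 ≤ d) (hb : 0 < b) (h : b ≤ c * (1 + d)) :
    ((1 + d) ^ 4)⁻¹ ≤ (c / b) ^ 4 := by
  have h1 : 0 < 1 + d := by linarith
  have hc : 0 < c := by
    by_contra hc
    push Not at hc
    have : c * (1 + d) ≤ 0 := mul_nonpos_of_nonpos_of_nonneg hc h1.le
    linarith
  have hbc : b / c ≤ 1 + d := by rw [div_le_iff₀ hc]; linarith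
  calc ((1 + d) ^ 4)⁻¹ ≤ ((b / c) ^ 4)⁻¹ := inv_anti₀ (by positivity) (pow_le_pow_left₀ (by positivity) hbc 4)
    _ = (c / b) ^ 4 := by rw [← inv_pow, inv_div]

/-- `‖s • x‖ = s ‖x‖` for `0 ≤ s`. [folklore] -/
theorem norm_smul_siteToE {s : ℝ} (hs : 0 ≤ s) (x : Site 4) : ‖s • siteToE x‖ = s * ‖siteToE x‖ := by
  rw [norm_smul, Real.norm_of_nonneg hs]

/-- **FAR-FIELD SMEARING (abstract kernel).**  On the torus box of half-side `L` at spacing `0 < s ≤ 1`, let the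
sampled sources `φ` (think `θv`) and `ψ` (think `v`) vanish outside the ball of radius `R₀` and be separated in time by
the wall gap `g > 0` (`φ ≠ 0 ⇒ y₀ ≤ −g`, `ψ ≠ 0 ⇒ y₀ ≥ g`), let the torus be large enough that no source pair wraps
around (`2R₀ ≤ s L`), and let the kernel obey the scale-free triangle majorant
`|K x y z| ≤ A · ω(d_T(x,y)) ω(d_T(x,z)) ω(d_T(y,z))`, `ω(d) = (1+d)^{-4}`.  Then the smeared kernel has FAR mass
`Σ_{x : D < ‖s x‖} |Σ_{y,z} φ(s y) ψ(s z) K x y z| ≤ 2¹⁴ A/(g⁴ D) · (s⁴Σ_y|φ(s y)|) · (s⁴Σ_z|ψ(s z)|)`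
for every `D ≥ max(2, 2R₀+1)` — uniformly in `s` and `L` (the two Riemann sums tend to `‖φ‖₁‖ψ‖₁`). -/
theorem far_sum_abs_smear_le (L : ℕ) {s : ℝ} (hs : 0 < s) (hs1 : s ≤ 1)
    (φ ψ : EuclideanSpace ℝ (Fin 4) → ℝ) {R₀ g : ℝ} (hg : 0 < g)
    (hφR : ∀ w, φ w ≠ 0 → ‖w‖ ≤ R₀) (hψR : ∀ w, ψ w ≠ 0 → ‖w‖ ≤ R₀)
    (hφt : ∀ w, φ w ≠ 0 → w 0 ≤ -g) (hψt : ∀ w, ψ w ≠ 0 → g ≤ w 0)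
    (hL : 2 * R₀ ≤ s * L)
    (K : Site 4 → Site 4 → Site 4 → ℝ) {A : ℝ} (hA : 0 ≤ A)
    (hK : ∀ x ∈ box 4 L, ∀ y ∈ box 4 L, ∀ z ∈ box 4 L,
      |K x y z| ≤ A * (((1 + torusDist L x y) ^ 4)⁻¹ * ((1 + torusDist L x z) ^ 4)⁻¹ * ((1 + torusDist L y z) ^ 4)⁻¹))
    {D : ℝ} (hD2 : 2 ≤ D) (hDR : 2 * R₀ + 1 ≤ D) :
    ∑ x ∈ (box 4 L).filter (fun x : Site 4 => D < ‖s • siteToE x‖),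
        |∑ y ∈ box 4 L, ∑ z ∈ box 4 L, φ (s • siteToE y) * ψ (s • siteToE z) * K x y z|
      ≤ 2 ^ 14 * A / (g ^ 4 * D) * (s ^ 4 * ∑ y ∈ box 4 L, |φ (s • siteToE y)|) *
          (s ^ 4 * ∑ z ∈ box 4 L, |ψ (s • siteToE z)|) := by
  -- coordinates of scaled sites (tree one-liners `UVSeamRec.UnitTransfer.smul_siteToE_apply_zero`,
  -- `BraidedSheetCoords.abs_apply_zero_le_norm`, restated locally to keep the imports light)
  have e0 : ∀ x : Site 4, (s • siteToE x) 0 = s * (x 0 : ℝ) := fun x => by simp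
  have n0 : ∀ u : EuclideanSpace ℝ (Fin 4), |u 0| ≤ ‖u‖ := fun u => by
    have h := PiLp.norm_apply_le u 0
    rwa [Real.norm_eq_abs] at h
  set F := (box 4 L).filter (fun x : Site 4 => D < ‖s • siteToE x‖) with hF
  set Sφ := ∑ y ∈ box 4 L, |φ (s • siteToE y)| with hSφ
  set Sψ := ∑ z ∈ box 4 L, |ψ (s • siteToE z)| with hSψ
  have hSφ0 : 0 ≤ Sφ := Finset.sum_nonneg fun _ _ => abs_nonneg _
  have hSψ0 : 0 ≤ Sψ := Finset.sum_nonneg fun _ _ => abs_nonneg _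
  -- the per-site majorant of the kernel on contributing pairs
  set M : Site 4 → ℝ := fun x => 16 * A / g ^ 4 * (s ^ 12 * ((1 + ‖s • siteToE x‖) ^ 8)⁻¹) with hM
  have hM0 : ∀ x, 0 ≤ M x := fun x => by positivity
  -- (1) the y–z leg: time separation, no wrap-around
  have hyz : ∀ y ∈ box 4 L, ∀ z ∈ box 4 L, φ (s • siteToE y) ≠ 0 → ψ (s • siteToE z) ≠ 0 →
      ((1 + torusDist L y z) ^ 4)⁻¹ ≤ (s / (2 * g)) ^ 4 := by
    intro y _ z _ hφ hψ
    have ht1 : s * (y 0 : ℝ) ≤ -g := by rw [← e0]; exact hφt _ hφ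
    have ht2 : g ≤ s * (z 0 : ℝ) := by rw [← e0]; exact hψt _ hψ
    have hn1 : |s * (y 0 : ℝ)| ≤ R₀ := by
      rw [← e0]; exact (n0 _).trans (hφR _ hφ)
    have hn2 : |s * (z 0 : ℝ)| ≤ R₀ := by
      rw [← e0]; exact (n0 _).trans (hψR _ hψ)
    -- no wrap: `|y₀ − z₀| ≤ L`
    have hgap : 2 * g ≤ s * |((y 0 : ℝ)) - (z 0 : ℝ)| := by
      have : s * |((y 0 : ℝ)) - (z 0 : ℝ)| ≥ s * ((z 0 : ℝ) - y 0) := by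
        rw [ge_iff_le]; refine mul_le_mul_of_nonneg_left ?_ hs.le
        rw [abs_sub_comm]; exact le_abs_self _
      nlinarith
    have hnowrapR : s * |((y 0 : ℝ)) - (z 0 : ℝ)| ≤ s * L := by
      have h1 : s * |((y 0 : ℝ)) - (z 0 : ℝ)| = |s * (y 0 : ℝ) - s * (z 0 : ℝ)| := by
        rw [← mul_sub, abs_mul, abs_of_pos hs]
      rw [h1]
      calc |s * (y 0 : ℝ) - s * (z 0 : ℝ)| ≤ |s * (y 0 : ℝ)| + |s * (z 0 : ℝ)| := abs_sub _ _
        _ ≤ R₀ + R₀ := add_le_add hn1 hn2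
        _ = 2 * R₀ := by ring
        _ ≤ s * L := hL
    have hnowrap : |y 0 - z 0| ≤ (L : ℤ) := by
      have h1 : |((y 0 : ℝ)) - (z 0 : ℝ)| ≤ L := le_of_mul_le_mul_left hnowrapR hs
      have h2 : (((|y 0 - z 0| : ℤ)) : ℝ) ≤ ((L : ℤ) : ℝ) := by push_cast; exact h1
      exact_mod_cast h2
    have hd := abs_sub_le_torusDist L y z hnowrap
    have hd' : 2 * g ≤ s * (1 + torusDist L y z) := by nlinarith [torusDist_nonneg L y z]
    exact inv_one_add_pow_four_le_div_pow (torusDist_nonneg L y z) (by linarith) hd'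
  -- (2) the x–y (x–z) legs: a far site is torus-far from every source site
  have hxy : ∀ x ∈ F, ∀ y ∈ box 4 L, ∀ (χ : EuclideanSpace ℝ (Fin 4) → ℝ),
      (∀ w, χ w ≠ 0 → ‖w‖ ≤ R₀) → χ (s • siteToE y) ≠ 0 →
      ((1 + torusDist L x y) ^ 4)⁻¹ ≤ (2 * s / (1 + ‖s • siteToE x‖)) ^ 4 := by
    intro x hx y _ χ hχR hχ
    rw [hF, Finset.mem_filter] at hx
    have hfar : D < ‖s • siteToE x‖ := hx.2
    have hyR : ‖s • siteToE y‖ ≤ R₀ := hχR _ hχ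
    have hgeo := norm_sub_norm_le_torusDist L y hx.1
    have hsx : ‖s • siteToE x‖ = s * ‖siteToE x‖ := norm_smul_siteToE hs.le x
    have hsy : ‖s • siteToE y‖ = s * ‖siteToE y‖ := norm_smul_siteToE hs.le y
    have hkey : 1 + ‖s • siteToE x‖ ≤ 2 * s * (1 + torusDist L x y) := by
      have h1 : s * (‖siteToE x‖ - ‖siteToE y‖) ≤ s * torusDist L x y :=
        mul_le_mul_of_nonneg_left hgeo hs.le
      rw [mul_sub] at h1
      rw [hsx] at hfar ⊢
      rw [hsy] at hyR
      nlinarith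
    exact inv_one_add_pow_four_le_div_pow (torusDist_nonneg L x y) (by positivity) hkey
  -- (3) termwise domination on F
  have hterm : ∀ x ∈ F, ∀ y ∈ box 4 L, ∀ z ∈ box 4 L,
      |φ (s • siteToE y) * ψ (s • siteToE z) * K x y z| ≤
        |φ (s • siteToE y)| * |ψ (s • siteToE z)| * M x := by
    intro x hx y hy z hz
    rw [abs_mul, abs_mul]
    by_cases hφ : φ (s • siteToE y) = 0
    · rw [hφ]; simp
    by_cases hψ : ψ (s • siteToE z) = 0
    · rw [hψ]; simp
    refine mul_le_mul_of_nonneg_left ?_ (by positivity)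
    have hxF := hx
    rw [hF, Finset.mem_filter] at hx
    have h1 := hxy x hxF y hy φ hφR hφ
    have h2 := hxy x hxF z hz ψ hψR hψ
    have h3 := hyz y hy z hz hφ hψ
    have hw0 : ∀ d, 0 ≤ torusDist L x d → 0 ≤ ((1 + torusDist L x d) ^ 4)⁻¹ := fun d _ => by
      positivity
    have hpos : 0 < 1 + ‖s • siteToE x‖ := by positivity
    calc |K x y z| ≤ A * (((1 + torusDist L x y) ^ 4)⁻¹ * ((1 + torusDist L x z) ^ 4)⁻¹ * ((1 + torusDist L y z) ^ 4)⁻¹) :=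
          hK x hx.1 y hy z hz
      _ ≤ A * ((2 * s / (1 + ‖s • siteToE x‖)) ^ 4 * (2 * s / (1 + ‖s • siteToE x‖)) ^ 4 *
            (s / (2 * g)) ^ 4) := by
          refine mul_le_mul_of_nonneg_left ?_ hA
          refine mul_le_mul (mul_le_mul h1 h2 (hw0 z (torusDist_nonneg L x z)) (by positivity)) h3
            (by positivity) (by positivity)
      _ = M x := by
          rw [hM]
          field_simp
          ring
  -- (4) sum over y, z, then over far x
  have hinner : ∀ x ∈ F,
      |∑ y ∈ box 4 L, ∑ z ∈ box 4 L, φ (s • siteToE y) * ψ (s • siteToE z) * K x y z| ≤ M x * (Sφ * Sψ) := by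
    intro x hx
    calc |∑ y ∈ box 4 L, ∑ z ∈ box 4 L, φ (s • siteToE y) * ψ (s • siteToE z) * K x y z|
        ≤ ∑ y ∈ box 4 L, |∑ z ∈ box 4 L, φ (s • siteToE y) * ψ (s • siteToE z) * K x y z| :=
          Finset.abs_sum_le_sum_abs _ _
      _ ≤ ∑ y ∈ box 4 L, ∑ z ∈ box 4 L, |φ (s • siteToE y) * ψ (s • siteToE z) * K x y z| :=
          Finset.sum_le_sum fun y _ => Finset.abs_sum_le_sum_abs _ _
      _ ≤ ∑ y ∈ box 4 L, ∑ z ∈ box 4 L, |φ (s • siteToE y)| * |ψ (s • siteToE z)| * M x :=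
          Finset.sum_le_sum fun y hy => Finset.sum_le_sum fun z hz => hterm x hx y hy z hz
      _ = M x * (Sφ * Sψ) := by
          rw [hSφ, hSψ, Finset.sum_mul_sum]
          rw [Finset.mul_sum]
          refine Finset.sum_congr rfl fun y _ => ?_
          rw [Finset.mul_sum]
          refine Finset.sum_congr rfl fun z _ => ?_
          ring
  have hfar := sum_box_far_bracket_le hs hs1 L hD2
  have hD0 : 0 < D := by linarith
  clear_value Sφ Sψ
  have hsumM : ∑ x ∈ F, M x =
      16 * A / g ^ 4 * s ^ 8 * (s ^ 4 * ∑ x ∈ F, ((1 + ‖s • siteToE x‖) ^ 8)⁻¹) := by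
    rw [hM, Finset.mul_sum, Finset.mul_sum]
    exact Finset.sum_congr rfl fun x _ => by ring
  calc ∑ x ∈ F, |∑ y ∈ box 4 L, ∑ z ∈ box 4 L, φ (s • siteToE y) * ψ (s • siteToE z) * K x y z|
      ≤ ∑ x ∈ F, M x * (Sφ * Sψ) := Finset.sum_le_sum hinner
    _ = (∑ x ∈ F, M x) * (Sφ * Sψ) := by rw [Finset.sum_mul]
    _ = 16 * A / g ^ 4 * s ^ 8 * (s ^ 4 * ∑ x ∈ F, ((1 + ‖s • siteToE x‖) ^ 8)⁻¹) * (Sφ * Sψ) := by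
        rw [hsumM]
    _ ≤ 16 * A / g ^ 4 * s ^ 8 * (1024 / D) * (Sφ * Sψ) :=
        mul_le_mul_of_nonneg_right (mul_le_mul_of_nonneg_left hfar (by positivity)) (by positivity)
    _ = 2 ^ 14 * A / (g ^ 4 * D) * (s ^ 4 * Sφ) * (s ^ 4 * Sψ) := by
        field_simp
        ring

/-! ## Specialisation to the response profile `respM` of the localisation line -/

section RespM

open Literature.MathematicalPhysics.QuantumFieldTheory
open Summit.QuantumFields.YangMills.Cruxes.OSLegsFromFemtoAndGap.DlrCollarTransfer
open Summit.QuantumFields.YangMills.Cruxes.ResponseLocalisation.Birth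

/-- Support bookkeeping: if `tsupport v ⊆ closedBall p ρ` and `v w ≠ 0` then `‖w‖ ≤ ‖p‖ + ρ` and
`p₀ − ρ ≤ w₀`. [folklore] -/
theorem norm_le_of_apply_ne_zero (v : 𝓢(EuclideanSpace ℝ (Fin 4), ℝ)) {p : EuclideanSpace ℝ (Fin 4)} {ρ : ℝ}
    (hv : tsupport v ⊆ Metric.closedBall p ρ) {w : EuclideanSpace ℝ (Fin 4)} (hw : v w ≠ 0) :
    ‖w‖ ≤ ‖p‖ + ρ ∧ p 0 - ρ ≤ w 0 := by
  have hmem : w ∈ Metric.closedBall p ρ := hv (subset_tsupport _ (Function.mem_support.mpr hw))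
  rw [Metric.mem_closedBall, dist_eq_norm] at hmem
  refine ⟨?_, ?_⟩
  · calc ‖w‖ = ‖(w - p) + p‖ := by rw [sub_add_cancel]
      _ ≤ ‖w - p‖ + ‖p‖ := norm_add_le _ _
      _ ≤ ‖p‖ + ρ := by linarith
  · have h : |(w - p) 0| ≤ ‖w - p‖ := by
      have h := PiLp.norm_apply_le (w - p) 0
      rwa [Real.norm_eq_abs] at h
    have h0 : (w - p) 0 = w 0 - p 0 := by simp
    rw [h0] at h
    have h' := (abs_le.mp (h.trans hmem)).1
    linarith

/-- Support bookkeeping for the reflected source: if `tsupport v ⊆ closedBall p ρ` and `(θv) w ≠ 0` then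
`‖w‖ ≤ ‖p‖ + ρ` and `w₀ ≤ −(p₀ − ρ)` (`θ` is an isometry reversing the time coordinate). [folklore] -/
theorem norm_le_of_thetaTest_apply_ne_zero (v : 𝓢(EuclideanSpace ℝ (Fin 4), ℝ)) {p : EuclideanSpace ℝ (Fin 4)}
    {ρ : ℝ} (hv : tsupport v ⊆ Metric.closedBall p ρ) {w : EuclideanSpace ℝ (Fin 4)}
    (hw : (thetaTest 4 v) w ≠ 0) :
    ‖w‖ ≤ ‖p‖ + ρ ∧ w 0 ≤ -(p 0 - ρ) := by
  rw [thetaTest_apply] at hw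
  obtain ⟨h1, h2⟩ := norm_le_of_apply_ne_zero v hv hw
  rw [LinearIsometryEquiv.norm_map] at h1
  have h3 : (timeReflection 4 w) 0 = -(w 0) := by simp [timeReflection_apply]
  rw [h3] at h2
  exact ⟨h1, by linarith⟩

variable (G : Type) [Group G] [TopologicalSpace G] [IsTopologicalGroup G] [CompactSpace G]
  [MeasurableSpace G] [BorelSpace G] (r : LatticeRep G)

/-- **FAR-FIELD CEILING OF THE RESPONSE PROFILE FROM A TRIANGLE MAJORANT.**  For a real Schwartz source `v`
supported in `closedBall p ρ` with `ρ < p₀` (time gap `g = p₀ − ρ`, radius `R₀ = ‖p‖ + ρ`), spacing `0 < s ≤ 1`, a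
torus with `2R₀ ≤ s L` (no wrap-around of the source pair) and a third cumulant obeying the scale-free triangle
majorant `|torusK3(x,y,z)| ≤ A ω(d_T(x,y)) ω(d_T(x,z)) ω(d_T(y,z))` on the box, the response profile
`respM(x) = Σ_{y,z} θv(s y) v(s z) torusK3(x,y,z)` has far mass
`Σ_{x : D < ‖s x‖} |respM(x)| ≤ 2¹⁴ A/((p₀−ρ)⁴ D) · (s⁴Σ_y|θv(s y)|) · (s⁴Σ_z|v(s z)|)` for `D ≥ max(2, 2R₀+1)`,
uniformly in `s`, `L` (and in `β`, which enters only through `A`).  This is the analysis half of a far-field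
stub of the repaired localisation crux (item 24293); the physics half is the majorant. -/
theorem far_sum_abs_respM_le (β : ℝ) (L : ℕ) {s : ℝ} (hs : 0 < s) (hs1 : s ≤ 1)
    (v : 𝓢(EuclideanSpace ℝ (Fin 4), ℝ)) {p : EuclideanSpace ℝ (Fin 4)} {ρ : ℝ} (hρp : ρ < p 0)
    (hv : tsupport v ⊆ Metric.closedBall p ρ) (hL : 2 * (‖p‖ + ρ) ≤ s * L) {A : ℝ} (hA : 0 ≤ A)
    (hK : ∀ x ∈ box 4 L, ∀ y ∈ box 4 L, ∀ z ∈ box 4 L,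
      |torusK3 G r β L x y z| ≤
        A * (((1 + torusDist L x y) ^ 4)⁻¹ * ((1 + torusDist L x z) ^ 4)⁻¹ * ((1 + torusDist L y z) ^ 4)⁻¹))
    {D : ℝ} (hD2 : 2 ≤ D) (hDR : 2 * (‖p‖ + ρ) + 1 ≤ D) :
    ∑ x ∈ (box 4 L).filter (fun x : Site 4 => D < ‖s • siteToE x‖), |respM G r β L s v x| ≤
      2 ^ 14 * A / ((p 0 - ρ) ^ 4 * D) * (s ^ 4 * ∑ y ∈ box 4 L, |(thetaTest 4 v) (s • siteToE y)|) *
        (s ^ 4 * ∑ z ∈ box 4 L, |v (s • siteToE z)|) := by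
  have h := far_sum_abs_smear_le L hs hs1 (fun w => (thetaTest 4 v) w) (fun w => v w)
    (R₀ := ‖p‖ + ρ) (g := p 0 - ρ) (by linarith)
    (fun w hw => (norm_le_of_thetaTest_apply_ne_zero v hv hw).1)
    (fun w hw => (norm_le_of_apply_ne_zero v hv hw).1)
    (fun w hw => (norm_le_of_thetaTest_apply_ne_zero v hv hw).2)
    (fun w hw => (norm_le_of_apply_ne_zero v hv hw).2)
    hL (torusK3 G r β L) hA hK hD2 hDR
  simpa only [respM] using h

/-- The same far-field ceiling in the indicator form used by the line's composition
(`Σ_{x ∈ box L} (if D < ‖s x‖ then |respM x| else 0)`). -/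
theorem far_ifsum_abs_respM_le (β : ℝ) (L : ℕ) {s : ℝ} (hs : 0 < s) (hs1 : s ≤ 1)
    (v : 𝓢(EuclideanSpace ℝ (Fin 4), ℝ)) {p : EuclideanSpace ℝ (Fin 4)} {ρ : ℝ} (hρp : ρ < p 0)
    (hv : tsupport v ⊆ Metric.closedBall p ρ) (hL : 2 * (‖p‖ + ρ) ≤ s * L) {A : ℝ} (hA : 0 ≤ A)
    (hK : ∀ x ∈ box 4 L, ∀ y ∈ box 4 L, ∀ z ∈ box 4 L,
      |torusK3 G r β L x y z| ≤
        A * (((1 + torusDist L x y) ^ 4)⁻¹ * ((1 + torusDist L x z) ^ 4)⁻¹ * ((1 + torusDist L y z) ^ 4)⁻¹))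
    {D : ℝ} (hD2 : 2 ≤ D) (hDR : 2 * (‖p‖ + ρ) + 1 ≤ D) :
    ∑ x ∈ box 4 L, (if D < ‖s • siteToE x‖ then |respM G r β L s v x| else 0) ≤
      2 ^ 14 * A / ((p 0 - ρ) ^ 4 * D) * (s ^ 4 * ∑ y ∈ box 4 L, |(thetaTest 4 v) (s • siteToE y)|) *
        (s ^ 4 * ∑ z ∈ box 4 L, |v (s • siteToE z)|) := by
  rw [← Finset.sum_filter]
  exact far_sum_abs_respM_le G r β L hs hs1 v hρp hv hL hA hK hD2 hDR

/-- **FAR-FIELD CEILING OF THE REPAIRED CRUX — ε-FORM, UNIFORM OVER THE L¹-NORMALISED FAMILY.**  For a base point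
`p`, a radius `ρ < p₀`, a majorant constant `A ≥ 0` and a tolerance `η > 0` there is ONE physical radius `D > 0` such that
for EVERY real Schwartz `v` with `tsupport v ⊆ closedBall p ρ` and `∫|v| ≤ 1` there is a spacing threshold `s₀ > 0`
(depending on `v` only through the convergence of its lattice `ℓ¹`-sums, `…UniformSmearPrep.exists_latticeSum_abs_le`)
with: for all spacings `0 < s ≤ s₀`, all tori with `2(‖p‖+ρ) ≤ s·L`, and every coupling `β` at which the torus third
cumulant obeys the triangle majorant with constant `A`, the far mass of the response profile is at most `η`:
`Σ_{x ∈ box L} 𝟙{D < ‖s x‖} |respM_{β,L,s}(x)| ≤ η`.  (Quantifier order of item 24293: `D` before `v`, thresholds after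
`v`; the physics input — the majorant for `β ≥ β₀`, `a(β)·L ≥ Λ₀` — is a hypothesis, NOT proved here.) -/
theorem far_ceiling_uniform (p : EuclideanSpace ℝ (Fin 4)) {ρ : ℝ} (hρp : ρ < p 0) {A : ℝ} (hA : 0 ≤ A)
    {η : ℝ} (hη : 0 < η) :
    ∃ D : ℝ, 0 < D ∧ ∀ v : 𝓢(EuclideanSpace ℝ (Fin 4), ℝ),
      tsupport (v : EuclideanSpace ℝ (Fin 4) → ℝ) ⊆ Metric.closedBall p ρ → (∫ y, |v y|) ≤ 1 →
      ∃ s₀ : ℝ, 0 < s₀ ∧ ∀ s : ℝ, 0 < s → s ≤ s₀ → ∀ L : ℕ, 2 * (‖p‖ + ρ) ≤ s * L → ∀ β : ℝ,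
        (∀ x ∈ box 4 L, ∀ y ∈ box 4 L, ∀ z ∈ box 4 L,
          |torusK3 G r β L x y z| ≤
            A * (((1 + torusDist L x y) ^ 4)⁻¹ * ((1 + torusDist L x z) ^ 4)⁻¹ *
              ((1 + torusDist L y z) ^ 4)⁻¹)) →
        ∑ x ∈ box 4 L, (if D < ‖s • siteToE x‖ then |respM G r β L s v x| else 0) ≤ η := by
  set R₀ : ℝ := ‖p‖ + ρ with hR₀
  set g : ℝ := p 0 - ρ with hg
  have hg0 : 0 < g := by rw [hg]; linarith
  set D : ℝ := max (max 2 (2 * R₀ + 1)) (2 ^ 16 * A / (g ^ 4 * η) + 1) with hD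
  have hD2 : 2 ≤ D := le_trans (le_max_left _ _) (le_max_left _ _)
  have hDR : 2 * R₀ + 1 ≤ D := le_trans (le_max_right _ _) (le_max_left _ _)
  have hDA : 2 ^ 16 * A / (g ^ 4 * η) < D := lt_of_lt_of_le (lt_add_one _) (le_max_right _ _)
  have hD0 : 0 < D := by linarith
  refine ⟨D, hD0, fun v hv hv1 => ?_⟩
  -- both sources are supported in `closedBall 0 R₀`
  have hvR : tsupport (v : EuclideanSpace ℝ (Fin 4) → ℝ) ⊆ Metric.closedBall 0 R₀ := by
    refine hv.trans (Metric.closedBall_subset_closedBall' ?_)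
    rw [hR₀, dist_zero_right]; linarith
  have hθR := Summit.QuantumFields.YangMills.Cruxes.NT.Reference.tsupport_thetaTest_subset_closedBall_zero hvR
  obtain ⟨s₁, hs₁, h₁⟩ := exists_latticeSum_abs_le v hvR
  obtain ⟨s₂, hs₂, h₂⟩ := exists_latticeSum_abs_le (thetaTest 4 v) hθR
  refine ⟨min (min s₁ s₂) 1, by positivity, fun s hs hss₀ L hL β hK => ?_⟩
  have hs1 : s ≤ 1 := le_trans hss₀ (min_le_right _ _)
  have hss₁ : s ≤ s₁ := le_trans hss₀ (le_trans (min_le_left _ _) (min_le_left _ _))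
  have hss₂ : s ≤ s₂ := le_trans hss₀ (le_trans (min_le_left _ _) (min_le_right _ _))
  have hRL : R₀ ≤ s * L := by
    have : 0 ≤ s * L := by positivity
    by_cases hR : 0 ≤ R₀ <;> linarith
  have hSv : s ^ 4 * ∑ z ∈ box 4 L, |v (s • siteToE z)| ≤ 2 := by
    have := h₁ s hs hss₁ L hRL; linarith
  have hSθ : s ^ 4 * ∑ y ∈ box 4 L, |(thetaTest 4 v) (s • siteToE y)| ≤ 2 := by
    have := h₂ s hs hss₂ L hRL
    rw [Summit.QuantumFields.YangMills.Cruxes.NT.CeilingPrice.integral_abs_thetaTest] at this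
    linarith
  have hmain := far_ifsum_abs_respM_le G r β L hs hs1 v hρp hv hL hA hK hD2 hDR
  have hSθ0 : 0 ≤ s ^ 4 * ∑ y ∈ box 4 L, |(thetaTest 4 v) (s • siteToE y)| := by positivity
  have hSv0 : 0 ≤ s ^ 4 * ∑ z ∈ box 4 L, |v (s • siteToE z)| := by positivity
  have hcoef0 : 0 ≤ 2 ^ 14 * A / ((p 0 - ρ) ^ 4 * D) := by rw [← hg]; positivity
  have hg4 : 0 < g ^ 4 := by positivity
  calc ∑ x ∈ box 4 L, (if D < ‖s • siteToE x‖ then |respM G r β L s v x| else 0)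
      ≤ 2 ^ 14 * A / ((p 0 - ρ) ^ 4 * D) * (s ^ 4 * ∑ y ∈ box 4 L, |(thetaTest 4 v) (s • siteToE y)|) *
          (s ^ 4 * ∑ z ∈ box 4 L, |v (s • siteToE z)|) := hmain
    _ ≤ 2 ^ 14 * A / ((p 0 - ρ) ^ 4 * D) * 2 * 2 := by
        refine mul_le_mul (mul_le_mul_of_nonneg_left hSθ hcoef0) hSv hSv0 (by positivity)
    _ = 2 ^ 16 * A / (g ^ 4 * D) := by rw [← hg]; ring
    _ ≤ η := by
        rw [div_le_iff₀ (by positivity)]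
        have h1 : 2 ^ 16 * A < D * (g ^ 4 * η) := by rwa [div_lt_iff₀ (by positivity)] at hDA
        nlinarith

end RespM

end Summit.QuantumFields.YangMills.Cruxes.ResponseLocalisation.Far

end
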